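import Mathlib
import Literature.NumberTheory.Automorphic.AdelicGLnGlue
import Literature.NumberTheory.Automorphic.GKModuleOfDifferentiableRep
import Literature.NumberTheory.Automorphic.ArchimedeanExpChart
import Literature.NumberTheory.Automorphic.GL2CCoeffRepComplex
import HarnessLib

/-!
# Finite-dimensional differentiable representations of `G_∞` are smooth in the matrix
coordinates — crux HeckeEigenvalueField (stmt-Langlands-13632), line Sketch, stub DICT-W5

Statement.  Let `K` be a number field, `K_∞ = mixedSpace K`, `M = M_n(K_∞)` (operator norm, scope
`Matrix.Norms.Operator`), `G_∞ = GL_n(K_∞) = archGroupGL n K` (the full linear real group, Lie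
algebra all of `M`), and read a matrix `m ∈ M` in `G_∞` through
`u m = if h : IsUnit m then ⟨h.unit, _⟩ else 1`.  Let `τ : G_∞ → GL(E)` be a representation on a
finite-dimensional complex normed space `E` which is differentiable with differential
`dτ : 𝔤 → End E` in the weak sense of `RealMatrixGroup.IsDifferentiableRep` (continuous matrix
coefficients, `d/dt ℓ(τ(exp tX) v)|₀ = ℓ(dτ X v)`).  Then for every invertible `m₀` and `v ∈ E` the
map `m ↦ τ(u m) v` is `C^∞` at `m₀`, and its flat derivative along `m₀ X` is `τ(m₀) (dτ X v)`.

Proof (Borel–Wallach 2000, 0 §2.3; Knapp 2002, 0.§2–3).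
(1) *Strong derivative.*  `E` is finite-dimensional, so the weak derivative upgrades
(`hasDerivAt_of_dual`): `t ↦ τ(exp tX) w` has derivative `dτ X w` at `0`, and, translating by the
one-parameter group `exp (s X) = exp ((s - t) X) exp (tX)`, derivative `dτ X (τ(exp tX) w)` at every
`t`.
(2) *The one-parameter group is an exponential.*  With `T = dτ X` viewed in the Banach algebra
`E →L[ℝ] E`, the function `s ↦ exp ((t - s) T) (τ(exp sX) w)` has derivative
`-exp((t-s)T) T (τ(exp sX) w) + exp((t-s)T) (dτ X (τ(exp sX) w)) = 0`, hence is constant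
(`is_const_of_deriv_eq_zero`); comparing `s = t` and `s = 0` gives `τ(exp tX) w = exp (tT) w`.
(3) *Chart.*  Let `log` be a local logarithm on `M`, smooth near `1` with `exp (log y) = y` near `1`
(`exists_log_contDiffAt_nhds_one`).  For `m` near `m₀`, `u m = m₀ · exp (log (m₀⁻¹ m))` in `G_∞`,
so `τ(u m) v = τ(m₀) (exp (dτ (log (m₀⁻¹ m))) v)`; the right side is smooth at `m₀`
(`Y ↦ dτ Y` is real-linear on the finite-dimensional `M`, `exp` is analytic on `E →L[ℝ] E`).
(4) *Derivative.*  Along `γ t = m₀ exp (tX)` (`γ 0 = m₀`, `γ' 0 = m₀ X`) one has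
`u (γ t) = m₀ · exp (tX)` exactly, so `(τ(u ·) v) ∘ γ = t ↦ τ(m₀) (τ(exp tX) v)` has derivative
`τ(m₀) (dτ X v)` at `0` by (1); the chain rule identifies it with `D(τ(u ·) v)(m₀)(m₀ X)`.

Steps (1)–(2) are proved for an arbitrary linear real group `G`, steps (3)–(4) for `GL N A` over any
finite-dimensional coefficient algebra and any chart `u` agreeing with `m ↦ m` on invertible
matrices, and the stub is the definitional specialisation `A = K_∞`.
-/

set_option linter.dupNamespace false -- project-wide: `Summit.Langlands.Langlands` is the mandated namespace

noncomputable section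

open scoped Matrix.Norms.Operator ContDiff Topology Matrix Classical
open Filter NumberField NumberField.mixedEmbedding
open Literature.NumberTheory.Automorphic Literature.NumberTheory.Automorphic.RealMatrixGroup

-- Mathlib idiom (as in `GKModules`): commutator bracket on `Module.End` / matrix algebras
attribute [local instance 100] LieRing.ofAssociativeRing

namespace Summit.Langlands.Langlands.Theorems.HeckeEigenvalueField.Res

section OneParameter

variable {A : Type*} [NormedCommRing A] [NormedAlgebra ℝ A] [NormedAlgebra ℚ A] [CompleteSpace A]
  [StarRing A] {N : Type*} [Fintype N] [DecidableEq N] {G : RealMatrixGroup A N}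
  {E : Type*} [NormedAddCommGroup E] [NormedSpace ℂ E] [FiniteDimensional ℂ E]
  {τ : Representation ℂ G.carrier E} {dτ : G.lie →ₗ⁅ℝ⁆ Module.End ℂ E}

/-- `exp ((s + t) X) = exp (sX) exp (tX)` in `G`: `t ↦ exp (tX)` is a one-parameter subgroup.
Knapp 2002, 0.§2, Prop. 0.11(c). [folklore] -/
private theorem expMem_add_smul (s t : ℝ) (X : G.lie) :
    G.expMem ((s + t) • X) = G.expMem (s • X) * G.expMem (t • X) := by
  refine Subtype.ext ?_
  change expGL ((s + t) • (X : Matrix N N A)) =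
    expGL (s • (X : Matrix N N A)) * expGL (t • (X : Matrix N N A))
  exact expGL_add_smul s t _

/-- `exp 0 = 1` in `G`. Knapp 2002, 0.§2. [folklore] -/
private theorem expMem_zero : G.expMem 0 = 1 := by
  refine Subtype.ext ?_
  change expGL (0 : Matrix N N A) = 1
  exact expGL_zero

/-- **Strong derivative at `0`.**  For a differentiable representation on a finite-dimensional
space, `t ↦ τ(exp tX) w` has (norm) derivative `dτ X w` at `t = 0` (the weak derivative of
`IsDifferentiableRep` through every functional, upgraded by `hasDerivAt_of_dual`).
[cite: BorelWallach2000, 0 §2.3] -/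
private theorem hasDerivAt_rep_expMem_zero (hτ : IsDifferentiableRep G τ dτ) (X : G.lie) (w : E) :
    HasDerivAt (fun t : ℝ => τ (G.expMem (t • X)) w) (dτ X w) 0 :=
  hasDerivAt_of_dual fun ℓ => hτ.hasDerivAt_coeff X w ℓ

/-- **Strong derivative at every `t`**: `d/ds τ(exp sX) w |ₛ₌ₜ = dτ X (τ(exp tX) w)`
(translate: `exp (sX) = exp ((s - t) X) exp (tX)`). [cite: BorelWallach2000, 0 §2.3] -/
private theorem hasDerivAt_rep_expMem (hτ : IsDifferentiableRep G τ dτ) (X : G.lie) (w : E)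
    (t : ℝ) :
    HasDerivAt (fun s : ℝ => τ (G.expMem (s • X)) w) (dτ X (τ (G.expMem (t • X)) w)) t := by
  have h0 : HasDerivAt (fun s : ℝ => τ (G.expMem (s • X)) (τ (G.expMem (t • X)) w))
      (dτ X (τ (G.expMem (t • X)) w)) (t - t) := by
    rw [sub_self]
    exact hasDerivAt_rep_expMem_zero hτ X _
  refine (h0.comp_sub_const t t).congr_of_eventuallyEq (Eventually.of_forall fun s => ?_)
  show τ (G.expMem (s • X)) w = τ (G.expMem ((s - t) • X)) (τ (G.expMem (t • X)) w)
  rw [show G.expMem (s • X) = G.expMem ((s - t) • X) * G.expMem (t • X) by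
    rw [← expMem_add_smul, sub_add_cancel], map_mul, Module.End.mul_apply]

/-- **A one-parameter group in `GL(E)` is the exponential of its generator**:
`τ(exp tX) w = exp (t dτ X) w`, the exponential taken in the Banach algebra `E →L[ℝ] E`
(`s ↦ exp ((t - s) dτ X) (τ(exp sX) w)` has zero derivative, hence is constant).
Knapp 2002, 0.§2, Prop. 0.11–0.12. [cite: BorelWallach2000, 0 §2.3] -/
private theorem rep_expMem_smul_eq_exp (hτ : IsDifferentiableRep G τ dτ) (X : G.lie) (w : E)
    (t : ℝ) :
    τ (G.expMem (t • X)) w =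
      NormedSpace.exp (t • LinearMap.toContinuousLinearMap ((dτ X).restrictScalars ℝ)) w := by
  have hF : ∀ s : ℝ, HasDerivAt (fun s : ℝ =>
      NormedSpace.exp ((t - s) • LinearMap.toContinuousLinearMap ((dτ X).restrictScalars ℝ))
        (τ (G.expMem (s • X)) w)) 0 s := by
    intro s
    have hc := (hasDerivAt_exp_smul_const (𝕂 := ℝ)
      (LinearMap.toContinuousLinearMap ((dτ X).restrictScalars ℝ)) (t - s)).comp_const_sub t s
    refine (hc.clm_apply (hasDerivAt_rep_expMem hτ X w s)).congr_deriv ?_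
    rw [_root_.neg_apply, mul_apply_eq_comp,
      LinearMap.coe_toContinuousLinearMap', LinearMap.coe_restrictScalars, neg_add_cancel]
  have hconst := is_const_of_deriv_eq_zero (fun s => (hF s).differentiableAt)
    (fun s => (hF s).deriv) t 0
  simp only [sub_self, zero_smul, NormedSpace.exp_zero, one_apply_eq_self, sub_zero,
    expMem_zero, map_one, Module.End.one_apply] at hconst
  exact hconst

/-- `τ(exp X) w = exp (dτ X) w` (the case `t = 1`). [cite: BorelWallach2000, 0 §2.3] -/
private theorem rep_expMem_eq_exp (hτ : IsDifferentiableRep G τ dτ) (X : G.lie) (w : E) :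
    τ (G.expMem X) w =
      NormedSpace.exp (LinearMap.toContinuousLinearMap ((dτ X).restrictScalars ℝ)) w := by
  have h := rep_expMem_smul_eq_exp hτ X w 1
  rwa [one_smul, one_smul] at h

end OneParameter

set_option backward.isDefEq.respectTransparency false in
/-- **Smoothness in matrix coordinates on `GL N A`.**  For the full linear real group `GL N A`
over a finite-dimensional coefficient algebra (Lie algebra all of `M_N(A)`), a chart
`u : M_N(A) → GL N A` with `u m = m` on invertible matrices, a finite-dimensional differentiable
representation `τ` with differential `dτ`, `m₀` invertible and `v ∈ E`: `m ↦ τ(u m) v` is `C^∞` at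
`m₀` (near `m₀`, `τ(u m) v = τ(m₀) exp (dτ (log (m₀⁻¹ m))) v` for a local logarithm smooth near
`1`), and its derivative along `m₀ X` is `τ(m₀) (dτ X v)` (chain rule along `t ↦ m₀ exp (tX)`).
[cite: BorelWallach2000, 0 §2.3] -/
private theorem contDiffAt_matrix_of_isDifferentiableRep_gl
    {A : Type*} [NormedCommRing A] [NormedAlgebra ℝ A] [NormedAlgebra ℚ A] [CompleteSpace A]
    [StarRing A] [FiniteDimensional ℝ A] {N : Type*} [Fintype N] [DecidableEq N]
    {E : Type*} [NormedAddCommGroup E] [NormedSpace ℂ E] [FiniteDimensional ℂ E]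
    {τ : Representation ℂ (RealMatrixGroup.gl A N).carrier E}
    {dτ : (RealMatrixGroup.gl A N).lie →ₗ⁅ℝ⁆ Module.End ℂ E}
    (hτ : IsDifferentiableRep (RealMatrixGroup.gl A N) τ dτ)
    (u : Matrix N N A → (RealMatrixGroup.gl A N).carrier)
    (hu : ∀ (m : Matrix N N A) (h : IsUnit m), u m = ⟨h.unit, Subgroup.mem_top _⟩)
    {m₀ : Matrix N N A} (hm₀ : IsUnit m₀) (v : E) :
    ContDiffAt ℝ ∞ (fun m : Matrix N N A => τ (u m) v) m₀ ∧
      ∀ X : (RealMatrixGroup.gl A N).lie,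
        fderiv ℝ (fun m : Matrix N N A => τ (u m) v) m₀ (m₀ * (X : Matrix N N A)) =
          τ ⟨hm₀.unit, Subgroup.mem_top _⟩ (dτ X v) := by
  -- a local logarithm, smooth near `1`
  obtain ⟨log, hlogsm, hexplog, -⟩ := exists_log_contDiffAt_nhds_one (A := A) (N := N)
  -- `b = m₀⁻¹`
  obtain ⟨b, hbm, hmb⟩ : ∃ b : Matrix N N A, b * m₀ = 1 ∧ m₀ * b = 1 :=
    ⟨↑hm₀.unit⁻¹, hm₀.val_inv_mul, hm₀.mul_val_inv⟩
  -- the Lie algebra is all of `M_N(A)`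
  have hmem : ∀ m : Matrix N N A, m ∈ (RealMatrixGroup.gl A N).lie.toSubmodule := fun m =>
    LieSubalgebra.mem_top m
  -- the generator map `Φ : M_N(A) → (E →L[ℝ] E)`, `Φ Y = dτ Y`, a continuous real-linear map
  let Φₗ : Matrix N N A →ₗ[ℝ] (E →L[ℝ] E) :=
    { toFun := fun Y => LinearMap.toContinuousLinearMap ((dτ ⟨Y, hmem Y⟩).restrictScalars ℝ)
      map_add' := fun Y Y' => by
        ext w
        have h : (⟨Y + Y', hmem _⟩ : (RealMatrixGroup.gl A N).lie) = ⟨Y, hmem Y⟩ + ⟨Y', hmem Y'⟩ :=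
          rfl
        simp only [LinearMap.coe_toContinuousLinearMap', LinearMap.coe_restrictScalars,
          _root_.add_apply, h, map_add, LinearMap.add_apply]
      map_smul' := fun c Y => by
        ext w
        have h : (⟨c • Y, hmem _⟩ : (RealMatrixGroup.gl A N).lie) = c • ⟨Y, hmem Y⟩ := rfl
        simp only [LinearMap.coe_toContinuousLinearMap', LinearMap.coe_restrictScalars,
          _root_.smul_apply, RingHom.id_apply, h, map_smul, LinearMap.smul_apply] }
  let Φ : Matrix N N A →L[ℝ] (E →L[ℝ] E) := LinearMap.toContinuousLinearMap Φₗ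
  have hΦ : ∀ Y : Matrix N N A,
      Φ Y = LinearMap.toContinuousLinearMap ((dτ ⟨Y, hmem Y⟩).restrictScalars ℝ) := fun Y => rfl
  -- `τ(m₀)` as a continuous real-linear map
  let L₀ : E →L[ℝ] E :=
    LinearMap.toContinuousLinearMap ((τ ⟨hm₀.unit, Subgroup.mem_top _⟩).restrictScalars ℝ)
  have hL₀ : ∀ w : E, L₀ w = τ ⟨hm₀.unit, Subgroup.mem_top _⟩ w := fun w => rfl
  -- `exp` is smooth on the Banach algebra `E →L[ℝ] E`
  have hexp : ContDiff ℝ ∞ (NormedSpace.exp : (E →L[ℝ] E) → (E →L[ℝ] E)) :=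
    contDiff_iff_contDiffAt.2 fun T => (NormedSpace.exp_analytic (𝕂 := ℝ) T).contDiffAt
  -- the smooth model `m ↦ τ(m₀) (exp (dτ (log (m₀⁻¹ m))) v)` of our function near `m₀`
  have hmodel : ContDiffAt ℝ ∞
      (fun m : Matrix N N A => L₀ (NormedSpace.exp (Φ (log (b * m))) v)) m₀ := by
    have hlog : ContDiffAt ℝ ∞ (fun m : Matrix N N A => log (b * m)) m₀ := by
      have h1 : ContDiffAt ℝ ∞ log (b * m₀) := by
        rw [hbm]
        exact hlogsm.self_of_nhds
      exact h1.comp m₀ (contDiff_const.mul contDiff_id).contDiffAt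
    have h2 : ContDiffAt ℝ ∞ (fun m : Matrix N N A => NormedSpace.exp (Φ (log (b * m)))) m₀ :=
      hexp.contDiffAt.comp m₀ (Φ.contDiff.contDiffAt.comp m₀ hlog)
    exact L₀.contDiff.contDiffAt.comp m₀ (h2.clm_apply contDiffAt_const)
  -- near `m₀`, `m₀⁻¹ m` is near `1`
  have htend : Tendsto (fun m : Matrix N N A => b * m) (𝓝 m₀) (𝓝 1) := by
    have h := (continuous_const_mul b).tendsto m₀
    rwa [hbm] at h
  -- key identity: if `exp (log (m₀⁻¹ m)) = m₀⁻¹ m` then `u m = m₀ · exp (log (m₀⁻¹ m))` in `GL N A`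
  have hkey : ∀ m : Matrix N N A, NormedSpace.exp (log (b * m)) = b * m →
      u m = ⟨hm₀.unit, Subgroup.mem_top _⟩ *
        (RealMatrixGroup.gl A N).expMem ⟨log (b * m), hmem _⟩ := by
    intro m hm
    have hm' : m = m₀ * NormedSpace.exp (log (b * m)) := by
      rw [hm, ← mul_assoc, hmb, one_mul]
    have hunit : IsUnit m := by
      rw [hm']
      exact hm₀.mul (Matrix.isUnit_exp _)
    rw [hu m hunit]
    refine Subtype.ext (Units.ext ?_)
    exact hm'
  have hev : (fun m : Matrix N N A => τ (u m) v) =ᶠ[𝓝 m₀] fun m : Matrix N N A =>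
      L₀ (NormedSpace.exp (Φ (log (b * m))) v) := by
    filter_upwards [htend.eventually hexplog] with m hm
    rw [hkey m hm, map_mul, Module.End.mul_apply, hL₀, hΦ, rep_expMem_eq_exp hτ]
  have hF : ContDiffAt ℝ ∞ (fun m : Matrix N N A => τ (u m) v) m₀ :=
    hmodel.congr_of_eventuallyEq hev
  refine ⟨hF, fun X => ?_⟩
  -- the derivative along `m₀ X`: differentiate along the curve `t ↦ m₀ exp (t X)`
  have hγd : HasDerivAt (fun t : ℝ => m₀ * NormedSpace.exp (t • (X : Matrix N N A)))
      (m₀ * (X : Matrix N N A)) 0 := by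
    have h := (hasDerivAt_exp_smul_const' (𝕂 := ℝ) (X : Matrix N N A) (0 : ℝ)).const_mul m₀
    simp only [zero_smul, NormedSpace.exp_zero, mul_one] at h
    exact h
  have hγu : ∀ t : ℝ, u (m₀ * NormedSpace.exp (t • (X : Matrix N N A))) =
      ⟨hm₀.unit, Subgroup.mem_top _⟩ * (RealMatrixGroup.gl A N).expMem (t • X) := by
    intro t
    rw [hu _ (hm₀.mul (Matrix.isUnit_exp _))]
    refine Subtype.ext (Units.ext ?_)
    rfl
  -- along the curve the function is `t ↦ τ(m₀) (τ(exp tX) v)`, with derivative `τ(m₀) (dτ X v)`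
  have hcurve : HasDerivAt ((fun m : Matrix N N A => τ (u m) v) ∘ fun t : ℝ =>
      m₀ * NormedSpace.exp (t • (X : Matrix N N A))) (L₀ (dτ X v)) 0 := by
    have h := L₀.hasFDerivAt.comp_hasDerivAt (0 : ℝ) (hasDerivAt_rep_expMem_zero hτ X v)
    refine h.congr_of_eventuallyEq (Eventually.of_forall fun t => ?_)
    show τ (u (m₀ * NormedSpace.exp (t • (X : Matrix N N A)))) v =
      L₀ (τ ((RealMatrixGroup.gl A N).expMem (t • X)) v)
    rw [hγu t, map_mul, Module.End.mul_apply, hL₀]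
  have h0 : m₀ = (fun t : ℝ => m₀ * NormedSpace.exp (t • (X : Matrix N N A))) 0 := by
    simp only [zero_smul, NormedSpace.exp_zero, mul_one]
  have hchain :=
    ((hF.differentiableAt (by simp)).hasFDerivAt).comp_hasDerivAt_of_eq (0 : ℝ) hγd h0
  rw [hchain.unique hcurve, hL₀]

/-- **Stub DICT-W5 (archimedean calculus): a finite-dimensional differentiable representation of
`G_∞` is smooth in the matrix coordinates, with derivative `τ(m₀) dτ(X)` along `m₀ X`.**
For `τ : G_∞ → GL(E)` with continuous coefficients and weak differential `dτ` along the
one-parameter groups (`IsDifferentiableRep`), `E` finite-dimensional: `t ↦ τ(exp tX)` is a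
one-parameter group with derivative `dτ X` at `0`, hence `τ(exp X) = exp(dτ X)`; with a local
logarithm at `1`, `m ↦ τ(m) v` (the matrix `m` read in `G_∞ = GL_n(K_∞)`, junk `1` off the
invertible matrices) is smooth at every invertible `m₀` and its derivative along `m₀ X` is
`τ(m₀) (dτ X v)`. [cite: BorelWallach2000, 0 §2.3] -/
theorem stub_isDifferentiableRep_contDiffAt_matrix {n : ℕ} {K : Type} [Field K] [NumberField K]
    {E : Type} [NormedAddCommGroup E] [NormedSpace ℂ E] [FiniteDimensional ℂ E]
    (τ : Representation ℂ (archGroupGL n K).carrier E)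
    (dτ : (archGroupGL n K).lie →ₗ⁅ℝ⁆ Module.End ℂ E)
    (hτ : IsDifferentiableRep (archGroupGL n K) τ dτ)
    {m₀ : Matrix (Fin n) (Fin n) (mixedSpace K)} (hm₀ : IsUnit m₀) (v : E) :
    ContDiffAt ℝ ∞ (fun m : Matrix (Fin n) (Fin n) (mixedSpace K) =>
        τ (if h : IsUnit m then ⟨h.unit, Subgroup.mem_top _⟩ else 1) v) m₀ ∧
      ∀ X : (archGroupGL n K).lie,
        fderiv ℝ (fun m : Matrix (Fin n) (Fin n) (mixedSpace K) =>
            τ (if h : IsUnit m then ⟨h.unit, Subgroup.mem_top _⟩ else 1) v) m₀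
            (m₀ * (X : Matrix (Fin n) (Fin n) (mixedSpace K))) =
          τ ⟨hm₀.unit, Subgroup.mem_top _⟩ (dτ X v) := by
  exact contDiffAt_matrix_of_isDifferentiableRep_gl hτ
    (fun m => if h : IsUnit m then ⟨h.unit, Subgroup.mem_top _⟩ else 1) (fun _ h => dif_pos h)
    hm₀ v

end Summit.Langlands.Langlands.Theorems.HeckeEigenvalueField.Res

end
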